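/- Fleet lead `ym-wcr-19456-p1` (seat g2), route `WeakCouplingRates`, crux `ColdBoxTwoPointFloorW` (stmt-QuantumFields-19608). -/
import Summits.QuantumFields.YangMills.Theses.WeakCouplingRates
import Summits.QuantumFields.YangMills.Theorems.WeakCouplingRatesColdBoxTwoPointFloorWStubBoxGaussianDomination
import Summits.QuantumFields.YangMills.Theorems.WeakCouplingRatesColdBoxTwoPointFloorWStubBoxKernelVsLattice

/-!
# Crux `ColdBoxTwoPointFloorW` (stmt-QuantumFields-19608) of route `WeakCouplingRates` — PROVED

`ColdBoxTwoPointFloorW_proof : Summit.QuantumFields.YangMills.Theses.WeakCouplingRates.ColdBoxTwoPointFloorW` — (BOX, window form, rev 2)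
there is a box-exponent ceiling `θ₀ > 0` (here `1/100`) such that for every `0 < A < θ ≤ θ₀` there is `c > 0` with: for all large `β`
the connected covariance of the two central `(1,2)`-plaquette costs at time separation `⌈β^A⌉` in the cold-wall `SU(2)` Wilson box of side
`2⌈β^θ⌉+1` satisfies `β²·Cov ≥ c·C(⌈β^A⌉)²`.

This is the kernel-checked composition `ColdBoxTwoPointFloorW_of` of the registered birth skeleton (line `birth`, v5 `541595052a14e13c`,
`Cruxes/ColdBoxTwoPointFloorW/Lines/birth.lean`) with its three stubs replaced by the tree theorems that landed them BY NAME: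
* S3a `stub_boxGaussianWick` (p439380, lead g0), S4 `stub_boxKernelVsLattice` (p452266, seat ym-wcr-19608-p2),
* S3c `stub_boxGaussianDomination` (p479849, lead g2: the one-scale expansion `boxDirichletDominationAbs` + `stub_boxGaussianDomination_of_abs`).
`c = c₁²` with `c₁` from S4.  No sorry, no hypothesis, standard axioms.  NOT the Clay mass gap: a finite-volume weak-coupling floor for one
Wilson box (the BOX half of the route's PW-CORR-POLY split; BULK_W is the separate crux stmt-QuantumFields-19609).
-/

set_option autoImplicit false

noncomputable section

namespace Summit.QuantumFields.YangMills.Theorems.WeakCouplingRates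

open Literature.MathematicalPhysics.QuantumLattice

/-- The Gaussian floor under the ceiling (S3c ∧ S3a): `Π² = ¾·2Π² − ½Π² ≤ β²·Cov`. -/
theorem boxGaussianFloorW : ∃ θ₀ : ℝ, 0 < θ₀ ∧ ∀ A θ : ℝ, 0 < A → A < θ → θ ≤ θ₀ → ∃ β₀ : ℝ, ∀ β : ℝ, β₀ ≤ β →
    boxMaxwellPlaqCov ⌈β ^ θ⌉₊ ⌈β ^ A⌉₊ ^ 2 ≤ β ^ 2 * boxPlaqCov (fundamentalRep (Fin 2)) β ⌈β ^ θ⌉₊ ⌈β ^ A⌉₊ := by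
  obtain ⟨θ₀, hθ₀, hdom⟩ := stub_boxGaussianDomination
  refine ⟨θ₀, hθ₀, fun A θ hA hAθ hθ => ?_⟩
  obtain ⟨β₀, hβ₀⟩ := hdom A θ hA hAθ hθ
  refine ⟨β₀, fun β hβ => ?_⟩
  have h := (abs_le.1 (hβ₀ β hβ)).1
  rw [stub_boxGaussianWick] at h
  linarith

/-- **Crux `ColdBoxTwoPointFloorW` of route `WeakCouplingRates`, PROVED** — the stubs BY NAME give the crux BY NAME: `θ₀` from S3c; for
`0 < A < θ ≤ θ₀` and `β ≥ max β₀ β₁`, `c₁²·C(T)² = (c₁|C(T)|)² ≤ Π² ≤ β²·boxPlaqCov`. -/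
theorem ColdBoxTwoPointFloorW_proof : Summit.QuantumFields.YangMills.Theses.WeakCouplingRates.ColdBoxTwoPointFloorW := by
  unfold Summit.QuantumFields.YangMills.Theses.WeakCouplingRates.ColdBoxTwoPointFloorW
  obtain ⟨θ₀, hθ₀, hfloor⟩ := boxGaussianFloorW
  refine ⟨θ₀, hθ₀, fun A θ hA hAθ hθ => ?_⟩
  obtain ⟨β₀, h₀⟩ := hfloor A θ hA hAθ hθ
  obtain ⟨c₁, hc₁, β₁, h₁⟩ := stub_boxKernelVsLattice A θ hA hAθ
  refine ⟨c₁ ^ 2, by positivity, max β₀ β₁, fun β hβ => ?_⟩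
  have h0 := h₀ β (le_trans (le_max_left _ _) hβ)
  have h1 := h₁ β (le_trans (le_max_right _ _) hβ)
  have h1' : (c₁ * |@Literature.MathematicalPhysics.QuantumFieldTheory.curvaturePlaquetteCorr 4 (by norm_num) (⌈β ^ A⌉₊ : ℤ)|) ^ 2 ≤
      |boxMaxwellPlaqCov ⌈β ^ θ⌉₊ ⌈β ^ A⌉₊| ^ 2 :=
    pow_le_pow_left₀ (by positivity) h1 2
  rw [sq_abs] at h1'
  calc c₁ ^ 2 * Literature.MathematicalPhysics.QuantumFieldTheory.curvaturePlaquetteCorr (d := 4) (by norm_num) (⌈β ^ A⌉₊ : ℤ) ^ 2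
        = (c₁ * |@Literature.MathematicalPhysics.QuantumFieldTheory.curvaturePlaquetteCorr 4 (by norm_num) (⌈β ^ A⌉₊ : ℤ)|) ^ 2 := by
          rw [mul_pow, sq_abs]
    _ ≤ boxMaxwellPlaqCov ⌈β ^ θ⌉₊ ⌈β ^ A⌉₊ ^ 2 := h1'
    _ ≤ _ := h0

end Summit.QuantumFields.YangMills.Theorems.WeakCouplingRates

end
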